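import Mathlib
import HarnessLib
import Literature.NumberTheory.Sieve.SelbergSymmetryFormula
import Literature.NumberTheory.Sieve.AsymptoticSieveForPrimesReduction
import Literature.NumberTheory.LFunctions.RosserSchoenfeldMertensFirstConstantCorollaries

/-!
# Route `IntegerScrew` — the von Mangoldt coupling form: the SHARP top eigenvalue `log M − γ + o(1)`

PIVOT-LAW §13.7 (f), PROP. N2 (the «Nyquist ratio» of the Suzuki screw ladder is `2π e^{−γ}`): for the
coupling form `B_M(c) = ∑_{m ≥ 1, n ≥ 1, mn ≤ M} Λ(n) n^{-1/2} c_{mn} c_m` (`2 B_M(c) = cᵀ N_M c`, see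
`IntegerScrewVonMangoldtCoupling.lean`, which proves `2 |B_M(c)| ≤ (log M + 6) ∑ c_k²`), this file proves
the asymptotically sharp upper bound

* `two_mul_abs_vonMangoldtCoupling_le_eventually` : for every `δ > 0`, for all sufficiently large `M` and
  every real `c`, `2 |B_M(c)| ≤ (log M − γ + δ) · ∑_{k ≤ M} c_k²`,

i.e. `ν_max(N_M) ≤ log M − γ + o(1)` (RH-free; `γ` = Euler's constant).  Proof (PIVOT-LAW §13.7 (f)):
a Collatz–Wielandt / weighted AM–GM bound with the weights `u_k = k^{-1/2} (1 + η k/M)`, `η ≍ 1/log M`: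
the ramp lowers the divisor part `∑_{d ∣ k} Λ(d)` of the `k`-th coefficient by `≍ η (k/M) log k` — which
beats the Mertens fluctuation `∑_{n ≤ M/k} Λ(n)/n − log(M/k) + γ` exactly in the boundary layer `k > M/Y`
where that fluctuation is not small — at the price `η·(log 4 + 4)` from Chebyshev's bound in the multiple
part.  Inputs: the tree's `Σ_{n ≤ x} Λ(n)/n − log x → −γ`
(`Literature.NumberTheory.LFunctions.tendsto_sum_vonMangoldt_div_sub_log`, Rosser–Schoenfeld 1962 (2.5),
(2.8)), the explicit `|Σ_{n ≤ x} Λ(n)/n − log x| ≤ 6`, Mathlib's `Chebyshev.psi_le_const_mul_self`, and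
the rearrangement `Literature.NumberTheory.Sieve.sum_sum_le_sum_divisorsAntidiagonal`.  Nothing here bears on
the truth of RH: these are unconditional facts about von Mangoldt's function.  References: M. Suzuki,
J. Lond. Math. Soc. (2) 108 (2023) 1448–1487 [Suzuki2023]; J. B. Rosser, L. Schoenfeld, Illinois J. Math. 6
(1962) 64–94 [RosserSchoenfeld1962]; H. L. Montgomery, R. C. Vaughan, *Multiplicative Number Theory I*, Thm 2.7.
-/

noncomputable section

-- D-0017: `Summit.<S>.<S>.…` is the designed namespace of a single-problem summit.
set_option linter.dupNamespace false

namespace Summit.RiemannHypothesis.RiemannHypothesis.Theorems.IntegerScrew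

open Finset ArithmeticFunction Filter

/-- `∑_{n ≤ X} Λ(n)/n ≤ log X + 6` for `X ≥ 1` (the tree's explicit Mertens estimate; restated privately so
that this file does not depend on the olean of `IntegerScrewVonMangoldtCoupling.lean`). -/
private theorem sum_vonMangoldt_div_self_le_six {X : ℕ} (hX : 1 ≤ X) :
    ∑ n ∈ Icc 1 X, Λ n / n ≤ Real.log X + 6 := by
  have h := Literature.NumberTheory.Sieve.SelbergSymmetry.abs_sum_vonMangoldt_div_sub_log_le
    (x := (X : ℝ)) (by exact_mod_cast hX)
  rw [Nat.floor_natCast] at h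
  have hI : Icc 1 X = Ioc 0 X := by ext m; simp only [mem_Icc, mem_Ioc]; omega
  rw [hI]
  have := (abs_le.1 h).2
  linarith

/-- Weighted AM–GM with a free positive parameter `t`:
`2·Λ(n) n^{-1/2} |a| |b| ≤ Λ(n)·t·a² + (Λ(n)/n)·t⁻¹·b²` for `n ≥ 1`, `t > 0`. -/
theorem two_mul_vonMangoldt_div_sqrt_mul_le_weighted {n : ℕ} (hn : 1 ≤ n) (a b : ℝ) {t : ℝ}
    (ht : 0 < t) :
    2 * (Λ n / Real.sqrt n * (|a| * |b|)) ≤ Λ n * t * a ^ 2 + Λ n / n * t⁻¹ * b ^ 2 := by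
  have hn0 : (0 : ℝ) < n := by exact_mod_cast hn
  set s : ℝ := Real.sqrt n with hs
  have hs0 : 0 < s := Real.sqrt_pos.mpr hn0
  have hss : s ^ 2 = (n : ℝ) := by rw [hs, Real.sq_sqrt hn0.le]
  have hΛ : 0 ≤ Λ n := vonMangoldt_nonneg
  have key : 0 ≤ Λ n * (s * t * |a| - |b|) ^ 2 := mul_nonneg hΛ (sq_nonneg _)
  have h1 : 2 * (Λ n / s * (|a| * |b|)) = (2 * Λ n * s * t * |a| * |b|) / (s ^ 2 * t) := by
    field_simp
  have h2 : Λ n * t * a ^ 2 + Λ n / n * t⁻¹ * b ^ 2 =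
      (Λ n * s ^ 2 * t ^ 2 * a ^ 2 + Λ n * b ^ 2) / (s ^ 2 * t) := by
    rw [← hss]
    field_simp
  rw [h1, h2]
  apply div_le_div_of_nonneg_right _ (by positivity)
  have ha : |a| ^ 2 = a ^ 2 := sq_abs a
  have hb : |b| ^ 2 = b ^ 2 := sq_abs b
  have hexp : Λ n * (s * t * |a| - |b|) ^ 2 =
      Λ n * s ^ 2 * t ^ 2 * |a| ^ 2 - 2 * Λ n * s * t * |a| * |b| + Λ n * |b| ^ 2 := by ring
  rw [hexp, ha, hb] at key
  linarith

/-- The ramp weights `w_k = 1 + η k/M`. -/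
def rampWeight (η : ℝ) (M k : ℕ) : ℝ := 1 + η * (k : ℝ) / M

/-- The ramp weights are positive for `η ≥ 0`. -/
theorem rampWeight_pos {η : ℝ} (hη : 0 ≤ η) (M k : ℕ) : 0 < rampWeight η M k := by
  unfold rampWeight
  have : 0 ≤ η * (k : ℝ) / M := by positivity
  linarith

/-- Divisor side of the ramp: for `mn = k ≤ M`, `n ≥ 2`, `0 ≤ η ≤ 1`:
`w_m / w_k ≤ 1 − η k/(4M)`. -/
theorem rampWeight_div_le {η : ℝ} (hη0 : 0 ≤ η) (hη1 : η ≤ 1) {M m n : ℕ} (hM : 1 ≤ M)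
    (hn : 2 ≤ n) (hk : m * n ≤ M) :
    rampWeight η M m / rampWeight η M (m * n) ≤ 1 - η * ((m * n : ℕ) : ℝ) / (4 * M) := by
  have hwk := rampWeight_pos hη0 M (m * n)
  rw [div_le_iff₀ hwk]
  unfold rampWeight
  have hM0 : (0 : ℝ) < M := by exact_mod_cast hM
  have hkM : ((m * n : ℕ) : ℝ) ≤ M := by exact_mod_cast hk
  have hk0 : (0 : ℝ) ≤ ((m * n : ℕ) : ℝ) := by positivity
  have hm2 : 2 * (m : ℝ) ≤ ((m * n : ℕ) : ℝ) := by
    have : 2 * m ≤ m * n := by nlinarith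
    exact_mod_cast this
  -- set x = η k / M ∈ [0, 1]
  set x : ℝ := η * ((m * n : ℕ) : ℝ) / M with hx
  have hx0 : 0 ≤ x := by positivity
  have hx1 : x ≤ 1 := by
    rw [hx, div_le_one hM0]
    nlinarith
  have hxm : η * (m : ℝ) / M ≤ x / 2 := by
    rw [hx]
    have : η * (m : ℝ) ≤ η * ((m * n : ℕ) : ℝ) / 2 := by nlinarith
    calc η * (m : ℝ) / M ≤ (η * ((m * n : ℕ) : ℝ) / 2) / M := by gcongr
      _ = η * ((m * n : ℕ) : ℝ) / M / 2 := by ring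
  have hrhs : (1 - η * ((m * n : ℕ) : ℝ) / (4 * M)) * (1 + η * ((m * n : ℕ) : ℝ) / M) =
      (1 - x / 4) * (1 + x) := by rw [hx]; ring
  rw [hrhs]
  nlinarith

/-- Multiple side of the ramp: for `η ≥ 0`, `w_{mn}/w_m ≤ 1 + η m n/M`. -/
theorem rampWeight_mul_div_le {η : ℝ} (hη0 : 0 ≤ η) (M m n : ℕ) :
    rampWeight η M (m * n) / rampWeight η M m ≤ 1 + η * (m : ℝ) * n / M := by
  have hwm := rampWeight_pos hη0 M m
  rw [div_le_iff₀ hwm]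
  unfold rampWeight
  have h1 : 0 ≤ η * (m : ℝ) / M := by positivity
  have h2 : 0 ≤ η * (m : ℝ) * n / M := by positivity
  have h12 : 0 ≤ η * (m : ℝ) * n / M * (η * (m : ℝ) / M) := mul_nonneg h2 h1
  have hexp : (1 + η * (m : ℝ) * n / M) * (1 + η * (m : ℝ) / M) =
      1 + η * (m : ℝ) * n / M + η * (m : ℝ) / M + η * (m : ℝ) * n / M * (η * (m : ℝ) / M) := by ring
  push_cast
  rw [hexp]
  have : η * ((m : ℝ) * n) / M = η * (m : ℝ) * n / M := by ring
  rw [this]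
  linarith

/-- Chebyshev in the form needed here: `∑_{n ≤ X} Λ(n) ≤ (log 4 + 4)·X`. -/
theorem sum_vonMangoldt_le_const_mul (X : ℕ) :
    ∑ n ∈ Icc 1 X, Λ n ≤ (Real.log 4 + 4) * X := by
  have h := Chebyshev.psi_le_const_mul_self (x := (X : ℝ)) (by positivity)
  have hI : Icc 1 X = Ioc 0 X := by ext m; simp only [mem_Icc, mem_Ioc]; omega
  rw [Chebyshev.psi, Nat.floor_natCast] at h
  rw [hI]
  exact h

/-- **The weighted coupling bound** (Collatz–Wielandt with the ramp `u_k = k^{-1/2}(1 + ηk/M)`):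
for `0 ≤ η ≤ 1` and `M ≥ 1`,
`2 |B_M(c)| ≤ ∑_{k ≤ M} [ (1 − ηk/(4M)) log k + ∑_{n ≤ M/k} Λ(n)/n + η (log 4 + 4) ] c_k²`. -/
theorem two_mul_abs_vonMangoldtCoupling_le_ramp {η : ℝ} (hη0 : 0 ≤ η) (hη1 : η ≤ 1) {M : ℕ}
    (hM : 1 ≤ M) (c : ℕ → ℝ) :
    2 * |∑ m ∈ Icc 1 M, ∑ n ∈ Icc 1 (M / m), Λ n / Real.sqrt n * (c (m * n) * c m)| ≤
      ∑ k ∈ Icc 1 M, ((1 - η * (k : ℝ) / (4 * M)) * Real.log k +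
        ∑ n ∈ Icc 1 (M / k), Λ n / n + η * (Real.log 4 + 4)) * c k ^ 2 := by
  set w : ℕ → ℝ := rampWeight η M with hw
  have hwpos : ∀ k, 0 < w k := fun k => rampWeight_pos hη0 M k
  have hM0 : (0 : ℝ) < M := by exact_mod_cast hM
  -- |∑∑| ≤ ∑∑ |·|
  have habs : |∑ m ∈ Icc 1 M, ∑ n ∈ Icc 1 (M / m), Λ n / Real.sqrt n * (c (m * n) * c m)| ≤
      ∑ m ∈ Icc 1 M, ∑ n ∈ Icc 1 (M / m), Λ n / Real.sqrt n * (|c (m * n)| * |c m|) := by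
    refine (abs_sum_le_sum_abs _ _).trans (sum_le_sum fun m _ => ?_)
    refine (abs_sum_le_sum_abs _ _).trans (sum_le_sum fun n _ => ?_)
    rw [abs_mul, abs_mul, abs_of_nonneg (div_nonneg vonMangoldt_nonneg (Real.sqrt_nonneg _))]
  -- termwise weighted AM–GM with t = w m / w (mn)
  have hamgm : 2 * ∑ m ∈ Icc 1 M, ∑ n ∈ Icc 1 (M / m), Λ n / Real.sqrt n * (|c (m * n)| * |c m|) ≤
      ∑ m ∈ Icc 1 M, ∑ n ∈ Icc 1 (M / m),
        (Λ n * (w m / w (m * n)) * c (m * n) ^ 2 + Λ n / n * (w (m * n) / w m) * c m ^ 2) := by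
    rw [mul_sum]
    refine sum_le_sum fun m hm => ?_
    rw [mul_sum]
    refine sum_le_sum fun n hn => ?_
    have hn1 : 1 ≤ n := (mem_Icc.1 hn).1
    have ht : 0 < w m / w (m * n) := div_pos (hwpos m) (hwpos (m * n))
    have h := two_mul_vonMangoldt_div_sqrt_mul_le_weighted hn1 (c (m * n)) (c m) ht
    have hinv : (w m / w (m * n))⁻¹ = w (m * n) / w m := by rw [inv_div]
    rw [hinv] at h
    exact h
  -- split
  have hsplit : ∑ m ∈ Icc 1 M, ∑ n ∈ Icc 1 (M / m),
        (Λ n * (w m / w (m * n)) * c (m * n) ^ 2 + Λ n / n * (w (m * n) / w m) * c m ^ 2) =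
      (∑ m ∈ Icc 1 M, ∑ n ∈ Icc 1 (M / m), Λ n * (w m / w (m * n)) * c (m * n) ^ 2) +
        ∑ m ∈ Icc 1 M, (∑ n ∈ Icc 1 (M / m), Λ n / n * (w (m * n) / w m)) * c m ^ 2 := by
    rw [← sum_add_distrib]
    refine sum_congr rfl fun m _ => ?_
    rw [sum_add_distrib, sum_mul]
  -- (1) the divisor part, rearranged over k = mn
  have hdiv : ∑ m ∈ Icc 1 M, ∑ n ∈ Icc 1 (M / m), Λ n * (w m / w (m * n)) * c (m * n) ^ 2 ≤
      ∑ k ∈ Icc 1 M, (1 - η * (k : ℝ) / (4 * M)) * Real.log k * c k ^ 2 := by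
    have h := Literature.NumberTheory.Sieve.sum_sum_le_sum_divisorsAntidiagonal
      (f := fun m n => Λ n * (w m / w (m * n)) * c (m * n) ^ 2)
      (fun m n => mul_nonneg (mul_nonneg vonMangoldt_nonneg (div_pos (hwpos _) (hwpos _)).le)
        (sq_nonneg _)) M
      (Icc 1 M) (fun m => Icc 1 (M / m)) (by
        intro m hm n hn
        obtain ⟨hm1, _⟩ := mem_Icc.1 hm
        obtain ⟨hn1, hnM⟩ := mem_Icc.1 hn
        refine ⟨hm1, hn1, ?_⟩
        have := (Nat.le_div_iff_mul_le (by omega)).1 hnM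
        simpa [Nat.mul_comm] using this)
    refine h.trans ?_
    have hI : Ioc 0 M = Icc 1 M := by ext m; simp only [mem_Icc, mem_Ioc]; omega
    rw [hI]
    refine sum_le_sum fun k hk => ?_
    have hk1 : 1 ≤ k := (mem_Icc.1 hk).1
    have hkM : k ≤ M := (mem_Icc.1 hk).2
    have hk0 : k ≠ 0 := by omega
    -- termwise on the antidiagonal: Λ(p.2) w(p.1)/w(k) ≤ Λ(p.2) (1 - ηk/(4M))
    have hterm : ∀ p ∈ k.divisorsAntidiagonal,
        Λ p.2 * (w p.1 / w (p.1 * p.2)) * c (p.1 * p.2) ^ 2 ≤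
          Λ p.2 * (1 - η * (k : ℝ) / (4 * M)) * c k ^ 2 := by
      intro p hp
      have hpk : p.1 * p.2 = k := (Nat.mem_divisorsAntidiagonal.1 hp).1
      rw [hpk]
      refine mul_le_mul_of_nonneg_right ?_ (sq_nonneg _)
      by_cases hp2 : p.2 < 2
      · -- p.2 = 0 or 1: Λ = 0
        have : Λ p.2 = 0 := by
          interval_cases h : p.2
          · simp
          · simp
        rw [this]; simp
      · have hp2 : 2 ≤ p.2 := not_lt.mp hp2
        have hle : w p.1 / w (p.1 * p.2) ≤ 1 - η * ((p.1 * p.2 : ℕ) : ℝ) / (4 * M) :=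
          rampWeight_div_le hη0 hη1 hM hp2 (by rw [hpk]; exact hkM)
        rw [hpk] at hle
        exact mul_le_mul_of_nonneg_left hle vonMangoldt_nonneg
    refine (sum_le_sum hterm).trans (le_of_eq ?_)
    rw [← sum_mul, ← sum_mul]
    congr 1
    have hΛ : ∑ p ∈ k.divisorsAntidiagonal, Λ p.2 = Real.log k := by
      rw [Nat.sum_divisorsAntidiagonal (f := fun _ b => (Λ b : ℝ)), ← vonMangoldt_sum]
      exact Nat.sum_div_divisors k (fun d => (Λ d : ℝ))
    rw [hΛ]
    ring
  -- (2) the multiple part: ∑_{n ≤ M/m} Λ(n)/n · w(mn)/w(m) ≤ ∑_{n ≤ M/m} Λ(n)/n + η (log 4 + 4)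
  have hmul : ∀ m ∈ Icc 1 M, ∑ n ∈ Icc 1 (M / m), Λ n / n * (w (m * n) / w m) ≤
      ∑ n ∈ Icc 1 (M / m), Λ n / n + η * (Real.log 4 + 4) := by
    intro m hm
    have hm1 : 1 ≤ m := (mem_Icc.1 hm).1
    have hmM : m ≤ M := (mem_Icc.1 hm).2
    have hm0 : (0 : ℝ) < m := by exact_mod_cast hm1
    have hX1 : 1 ≤ M / m := (Nat.le_div_iff_mul_le (by omega)).2 (by simpa using hmM)
    -- termwise: Λ/n · w(mn)/w(m) ≤ Λ/n + (η m/M) Λ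
    have hterm : ∀ n ∈ Icc 1 (M / m), Λ n / n * (w (m * n) / w m) ≤
        Λ n / n + η * (m : ℝ) / M * Λ n := by
      intro n hn
      have hn1 : 1 ≤ n := (mem_Icc.1 hn).1
      have hn0 : (0 : ℝ) < n := by exact_mod_cast hn1
      have hr := rampWeight_mul_div_le hη0 M m n
      have hΛn : 0 ≤ Λ n / n := div_nonneg vonMangoldt_nonneg hn0.le
      calc Λ n / n * (w (m * n) / w m) ≤ Λ n / n * (1 + η * (m : ℝ) * n / M) :=
            mul_le_mul_of_nonneg_left hr hΛn
        _ = Λ n / n + η * (m : ℝ) / M * Λ n := by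
            field_simp
    refine (sum_le_sum hterm).trans ?_
    rw [sum_add_distrib, ← mul_sum]
    have hcheb := sum_vonMangoldt_le_const_mul (M / m)
    have hXle : ((M / m : ℕ) : ℝ) ≤ (M : ℝ) / m := Nat.cast_div_le
    have hη' : 0 ≤ η * (m : ℝ) / M := by positivity
    have hbound : η * (m : ℝ) / M * ∑ n ∈ Icc 1 (M / m), Λ n ≤ η * (Real.log 4 + 4) := by
      calc η * (m : ℝ) / M * ∑ n ∈ Icc 1 (M / m), Λ n
          ≤ η * (m : ℝ) / M * ((Real.log 4 + 4) * ((M : ℝ) / m)) := by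
            refine mul_le_mul_of_nonneg_left (hcheb.trans ?_) hη'
            exact mul_le_mul_of_nonneg_left hXle (by positivity)
        _ = η * (Real.log 4 + 4) := by field_simp
    linarith
  have hmul' : ∑ m ∈ Icc 1 M, (∑ n ∈ Icc 1 (M / m), Λ n / n * (w (m * n) / w m)) * c m ^ 2 ≤
      ∑ m ∈ Icc 1 M, (∑ n ∈ Icc 1 (M / m), Λ n / n + η * (Real.log 4 + 4)) * c m ^ 2 :=
    sum_le_sum fun m hm => mul_le_mul_of_nonneg_right (hmul m hm) (sq_nonneg _)
  calc 2 * |∑ m ∈ Icc 1 M, ∑ n ∈ Icc 1 (M / m), Λ n / Real.sqrt n * (c (m * n) * c m)|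
      ≤ 2 * ∑ m ∈ Icc 1 M, ∑ n ∈ Icc 1 (M / m), Λ n / Real.sqrt n * (|c (m * n)| * |c m|) := by
        linarith
    _ ≤ (∑ m ∈ Icc 1 M, ∑ n ∈ Icc 1 (M / m), Λ n * (w m / w (m * n)) * c (m * n) ^ 2) +
        ∑ m ∈ Icc 1 M, (∑ n ∈ Icc 1 (M / m), Λ n / n * (w (m * n) / w m)) * c m ^ 2 := by
        rw [← hsplit]; exact hamgm
    _ ≤ (∑ k ∈ Icc 1 M, (1 - η * (k : ℝ) / (4 * M)) * Real.log k * c k ^ 2) +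
        ∑ m ∈ Icc 1 M, (∑ n ∈ Icc 1 (M / m), Λ n / n + η * (Real.log 4 + 4)) * c m ^ 2 := by
        linarith
    _ = ∑ k ∈ Icc 1 M, ((1 - η * (k : ℝ) / (4 * M)) * Real.log k +
        ∑ n ∈ Icc 1 (M / k), Λ n / n + η * (Real.log 4 + 4)) * c k ^ 2 := by
        rw [← sum_add_distrib]
        refine sum_congr rfl fun k _ => ?_
        ring


/-- `log k + log ⌊M/k⌋ ≤ log M` for `1 ≤ k ≤ M`. -/
theorem log_add_log_div_le {M k : ℕ} (hk : k ∈ Icc 1 M) :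
    Real.log k + Real.log ((M / k : ℕ) : ℝ) ≤ Real.log M := by
  obtain ⟨hk1, hkM⟩ := mem_Icc.1 hk
  have hX1 : 1 ≤ M / k := (Nat.le_div_iff_mul_le (by omega)).2 (by simpa using hkM)
  have hk0 : (0 : ℝ) < k := by exact_mod_cast hk1
  have hX0 : (0 : ℝ) < ((M / k : ℕ) : ℝ) := by exact_mod_cast hX1
  rw [← Real.log_mul hk0.ne' hX0.ne']
  refine Real.log_le_log (mul_pos hk0 hX0) ?_
  have h : k * (M / k) ≤ M := Nat.mul_div_le M k
  exact_mod_cast h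

/-- **PROP. N2, upper half** (PIVOT-LAW §13.7 (f)): for every `δ > 0`, for all sufficiently large `M` and
every real vector `c`, `2 |B_M(c)| ≤ (log M − γ + δ)·∑_{k ≤ M} c_k²` — the top eigenvalue of the von
Mangoldt coupling matrix `N_M` is at most `log M − γ + o(1)` (with `IntegerScrewVonMangoldtCoupling.lean`'s
flat-vector lower bound and `vonMangoldtCoupling_flat_ge_eventually` below, `ν_max(N_M) = log M − γ + o(1)`:
the Nyquist ratio of the screw ladder is `2π e^{−γ}`).  RH-free. -/
theorem two_mul_abs_vonMangoldtCoupling_le_eventually {δ : ℝ} (hδ : 0 < δ) :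
    ∀ᶠ M : ℕ in atTop, ∀ c : ℕ → ℝ,
      2 * |∑ m ∈ Icc 1 M, ∑ n ∈ Icc 1 (M / m), Λ n / Real.sqrt n * (c (m * n) * c m)| ≤
        (Real.log M - Real.eulerMascheroniConstant + δ) * ∑ k ∈ Icc 1 M, c k ^ 2 := by
  set γ : ℝ := Real.eulerMascheroniConstant with hγ
  have hγ1 : γ < 1 := by rw [hγ]; linarith [Real.eulerMascheroniConstant_lt_two_thirds]
  -- Mertens with its constant: ∑_{n ≤ x} Λ(n)/n − log x < −γ + δ/3 for x ≥ x₀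
  have hlim := Literature.NumberTheory.LFunctions.tendsto_sum_vonMangoldt_div_sub_log
  have hev : ∀ᶠ x : ℝ in atTop,
      ∑ n ∈ Finset.Ioc 0 ⌊x⌋₊, Λ n / n - Real.log x < -γ + δ / 3 :=
    (tendsto_order.1 hlim).2 _ (by rw [hγ]; linarith)
  obtain ⟨x₀, hx₀⟩ := eventually_atTop.1 hev
  -- the threshold Y ≥ 2, Y ≥ x₀
  set Y : ℕ := ⌈max x₀ 2⌉₊ with hYdef
  have hY2 : (2 : ℝ) ≤ Y := by rw [hYdef]; exact (le_max_right _ _).trans (Nat.le_ceil _)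
  have hYx : x₀ ≤ (Y : ℝ) := by rw [hYdef]; exact (le_max_left _ _).trans (Nat.le_ceil _)
  have hY0 : (0 : ℝ) < Y := by linarith
  have hmert : ∀ X : ℕ, Y ≤ X → ∑ n ∈ Icc 1 X, Λ n / n ≤ Real.log X - γ + δ / 3 := by
    intro X hX
    have hx : x₀ ≤ (X : ℝ) := hYx.trans (by exact_mod_cast hX)
    have h := hx₀ (X : ℝ) hx
    rw [Nat.floor_natCast] at h
    have hI : Icc 1 X = Ioc 0 X := by ext m; simp only [mem_Icc, mem_Ioc]; omega
    rw [hI]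
    linarith
  -- constants
  set Cψ : ℝ := Real.log 4 + 4 with hCψ
  have hCψ0 : 0 < Cψ := by rw [hCψ]; linarith [Real.log_pos (show (1 : ℝ) < 4 by norm_num)]
  set η₀ : ℝ := 64 * Y with hη₀
  have hη₀0 : 0 < η₀ := by rw [hη₀]; positivity
  -- log M → ∞ along ℕ
  have hlog : Tendsto (fun M : ℕ => Real.log M) atTop atTop :=
    Real.tendsto_log_atTop.comp tendsto_natCast_atTop_atTop
  filter_upwards [eventually_ge_atTop 3, hlog.eventually_ge_atTop η₀,
    hlog.eventually_ge_atTop (2 * Real.log Y), hlog.eventually_ge_atTop (3 * η₀ * Cψ / δ)]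
    with M hM3 hL1 hL2 hL3 c
  have hM1 : 1 ≤ M := by omega
  have hM0 : (0 : ℝ) < M := by exact_mod_cast (show 0 < M by omega)
  have hLpos : 0 < Real.log M := by linarith
  set η : ℝ := η₀ / Real.log M with hηdef
  have hη0 : 0 ≤ η := by rw [hηdef]; positivity
  have hη1 : η ≤ 1 := by rw [hηdef, div_le_one hLpos]; exact hL1
  have hηC : η * Cψ ≤ δ / 3 := by
    rw [hηdef, div_mul_eq_mul_div, div_le_iff₀ hLpos]
    have h := hL3
    rw [div_le_iff₀ hδ] at h
    linarith
  refine (two_mul_abs_vonMangoldtCoupling_le_ramp hη0 hη1 hM1 c).trans ?_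
  rw [mul_sum]
  refine sum_le_sum fun k hk => mul_le_mul_of_nonneg_right ?_ (sq_nonneg _)
  -- the k-th coefficient
  obtain ⟨hk1, hkM⟩ := mem_Icc.1 hk
  have hk0 : (0 : ℝ) < k := by exact_mod_cast hk1
  have hlogk : 0 ≤ Real.log k := Real.log_nonneg (by exact_mod_cast hk1)
  have hX1 : 1 ≤ M / k := (Nat.le_div_iff_mul_le (by omega)).2 (by simpa using hkM)
  have hsum := log_add_log_div_le hk
  have hgain0 : 0 ≤ η * (k : ℝ) / (4 * M) * Real.log k := by positivity
  by_cases hcase : Y ≤ M / k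
  · -- interior: Mertens with its constant
    have h1 := hmert (M / k) hcase
    have h2 : (1 - η * (k : ℝ) / (4 * M)) * Real.log k ≤ Real.log k := by nlinarith
    linarith
  · -- boundary layer k > M/Y: the ramp gain beats the fluctuation
    have hcase : M / k < Y := not_le.mp hcase
    have h1 := sum_vonMangoldt_div_self_le_six hX1
    -- M < Y k
    have hMk : M < Y * k := (Nat.div_lt_iff_lt_mul (by omega)).1 hcase
    have hMk' : (M : ℝ) < (Y : ℝ) * k := by exact_mod_cast hMk
    -- log k ≥ log M − log Y ≥ (log M)/2
    have hlogk2 : Real.log M / 2 ≤ Real.log k := by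
      have : Real.log M < Real.log Y + Real.log k := by
        rw [← Real.log_mul hY0.ne' hk0.ne']
        exact Real.log_lt_log hM0 hMk'
      linarith
    -- η k/(4M) ≥ η/(4Y)
    have hratio : η / (4 * Y) ≤ η * (k : ℝ) / (4 * M) := by
      rw [div_le_div_iff₀ (by positivity) (by positivity)]
      have : η * (M : ℝ) ≤ η * ((Y : ℝ) * k) := mul_le_mul_of_nonneg_left hMk'.le hη0
      nlinarith
    have hgain : 8 ≤ η * (k : ℝ) / (4 * M) * Real.log k := by
      have h8 : η / (4 * Y) * (Real.log M / 2) = 8 := by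
        rw [hηdef, hη₀]
        field_simp
        ring
      calc (8 : ℝ) = η / (4 * Y) * (Real.log M / 2) := h8.symm
        _ ≤ η * (k : ℝ) / (4 * M) * Real.log k :=
            mul_le_mul hratio hlogk2 (by positivity) (by positivity)
    have hexp : (1 - η * (k : ℝ) / (4 * M)) * Real.log k =
        Real.log k - η * (k : ℝ) / (4 * M) * Real.log k := by ring
    rw [hexp]
    have hδC : η * Cψ ≤ δ := by linarith
    linarith

end Summit.RiemannHypothesis.RiemannHypothesis.Theorems.IntegerScrew

end
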